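/-
Copyright (c) 2026 the pub-hodgecm-mathlib formalisation cell (harness21).  Prover seat hodgecm-mathlib-LH4-p12 (g0): (ρ) child (b′) «type-(1) H-side row (1) for the anchor», brick
(b′-1) «TYPE-(1) UNFOLDING, wild-safe» of CENSUS-U2H-bprime v2 (dealer LH4-plan (g10) WORD #44 routing; (ρ) cutter LH4-p06 (g0)).  Template: LH4-p13 (g0)'s ★ type-(2) column
`stableOrbitalIntegralRel_indicator_prod_top_eq_mul_natCard_fixedBy_of_not_exists_isRoot` (one class); here TWO classes.  2026-09-03.
-/
import Literature.NumberTheory.Rogawski1990.DepthZeroTransferHValuesTypeTwoRamified     -- ★ (LH4-p13 lineage): the type-(2) column and its whole unfolding kit (`classOrbitalIntegral_indicator_complex_eq_natCard_fixedBy_mul`, `natCard_fixedBy_quotient_prod_top_eq`, …)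
import Literature.NumberTheory.Rogawski1990.UnitStableOrbitalIntegralHSideCount          -- ★ `stableOrbitalIntegralRel_eq_add_of_two_classes`
import Literature.NumberTheory.Rogawski1990.UnitFundamentalLemmaInertResiduallyRegular   -- ★ `isLocalStablyConjH_of_isConj_and_conj`
import Literature.NumberTheory.Rogawski1990.LevelTwoLiftInteriorTypeOneCompact            -- ★ `compactSpace_centralizer_of_isLocalNormPair_of_isRoot` (type (1): compact `Z_G(x)`)
import Literature.NumberTheory.Rogawski1990.LocalEndoscopicTorusTransport                 -- ★ (Θ) `exists_localEndoCentralizerEquiv_normPair` (`Z_H(γ_H) ≃ₜ* Z_G(x)`)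
import Literature.NumberTheory.Rogawski1990.LocalTransferCompactSideJunctionCM              -- ★ `isLocalGRegular_of_isLocalStablyConjH`
import Literature.NumberTheory.Automorphic.LocalUnitaryGroupCongr                            -- ★ `antidiagOne_isHermitian`, `isUnit_antidiagOne_det`
import HarnessLib

/-!
# Crux `H413`, line LH4 «(D-RAM) FOUR-FRAME» road — unit U2H (ii-H), (ρ) child (b′), brick (b′-1): the TYPE-(1) UNFOLDING of the H-side indicator profiles at ANY
# non-split place — `Φ^st(γ_H, 1_{C × U₁}) = ν_H(C × U₁) · (#Fix_{γ₂}(U₂ ⧸ C) + #Fix_{γ₂′}(U₂ ⧸ C))`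

Cell `hodgecm-mathlib` (D-0151), FLOOR 0, crux item H413 = `stmt-HodgeConjecture-24833`, route of record `HCCMUnconditional`; squad F0∕P3c∕LH4 (req620 Track A); U2H ED. 6 stub (ρ)
`stub_U2H_rowsR_hFamily_unit0`, child (b′) = ROW (1)'s H-side identity for the anchor (p06 target text 335041993678acc8).  THEOREMS ONLY (no `def`, no instance, no notation,
no `sorry`); two `H_v`-sized statements carry `maxHeartbeats 400000` EXACTLY as the ★ template does (elaboration of the carriers, not search); imports ★ only; lane
`--supports stmt-HodgeConjecture-24833` (count-neutral).

WHAT IS PROVED (brick (b′-1) of `F0/P3c/LH4/LH4-p12/g0/CENSUS-U2H-bprime.v2.LH4p12g0.md`).  At a non-split place `w ∣ v` (ANY ramification, no `|2| = 1`, no `σϖ = −ϖ`), for the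
canonical family `mH` (normalised against a Haar measure `ν_H`), a compact open `C ≤ U(Φ₂)(L⁺_v)` and a `G`-regular TYPE-(1) ELLIPTIC `γ_H = (γ₂, γ₁)` (`χ_{γ₂}` has a root at `w`;
`γ_H` is not `H_v`-conjugate to a diagonal) together with a TWO-CLASS DATUM `γ_H′` (stably conjugate, not conjugate, exhausting the stable class — ★
`exists_isLocalStablyConjH_not_isConj_forall_isConj_or` provides one from an eigenframe):
* §1 `isCompact_centralizer_of_typeOne`: `Z_{H_v}(γ_H)` is compact — the `G`-side centraliser of `ι_v(γ_H)` is the norm-one torus (★ `compactSpace_centralizer_of_isLocalNormPair_of_isRoot`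
  at the norm pair `γ_H ↔ ι_v(γ_H)`), transported by ★ (Θ) `exists_localEndoCentralizerEquiv_normPair`; and so is `Z_{H_v}(γ_H′)` (★ `isCompact_centralizer_of_isLocalStablyConjH`-style
  transport, here re-derived from (Θ) at the norm pair `γ_H′ ↔ ι_v(γ_H)`).
* §2 **`stableOrbitalIntegralRel_indicator_prod_top_eq_mul_add_of_typeOne`**:
  `Φ^st(γ_H, 1_{C × U₁}) = ν_H(C × U₁) · (#Fix_{γ₂}(U₂ ⧸ C) + #Fix_{γ₂′}(U₂ ⧸ C))` — ★ two-class split `stableOrbitalIntegralRel_eq_add_of_two_classes`, per class the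
  mass-carrying unfolding ★ `classOrbitalIntegral_indicator_complex_eq_natCard_fixedBy_mul` (compact centraliser §1, closed orbit ★ `isClosed_conjClass_localH_of_isLocalGRegular`),
  and the compact factor `U₁` ★ `natCard_fixedBy_quotient_prod_top_eq`.
Both H-side profiles of ★ №5 `hFamily` are such indicators (`1_{K_H} = 1_{K₂ × ⊤}` ★ `hProfileZero_eq_indicator_prod_top`; `1_{K♯ × U₁}` via p13's `K♯` packaging), so (b′) is now
[this unfolding] + [the two fixed-point COUNTS on the U(Φ₂)-tree (bricks (b′-2)–(b′-4), p13's torus-form heads)] + arithmetic.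

HONEST LABEL.  Count-neutral; asserts no census law (the COUNTS are the open bricks); the verdict of record for (D-RAM) stays PRINT [LanglandsShelstad1989 Thm. p. 484 ∕ Rogawski1990
Prop. 4.9.1 (a)] ∕ XL; `HC_CM` is proved only modulo the 7 printed citations (2 remaining: hLiu418 = `stmt-HodgeConjecture-24832`, h413 = `stmt-HodgeConjecture-24833`) until rung 0 closes.

## References
* [Rogawski1990] J. D. Rogawski, *Automorphic Representations of Unitary Groups in Three Variables*, Ann. of Math. Stud. 123 (1990): §3.6 p. 31 (type (1): two classes in the
  stable class), §4.1 (4.1.1) p. 39 and §4.3 (4.3.1) p. 43 (stable orbital integrals), §4.9 Lemma 4.9.3 p. 56, §12.5 p. 184 (compact Cartan subgroups).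
* [LabesseLanglands1979] J.-P. Labesse, R. P. Langlands, *L-indistinguishability for SL(2)*, Canad. J. Math. 31 (1979), §2 (the two classes of an elliptic stable class).
* [Kottwitz1988] R. E. Kottwitz, *Tamagawa numbers*, Ann. of Math. 127 (1988), §2 (orbital integrals of the unit as fixed-point counts).
-/

set_option autoImplicit false

noncomputable section

open MeasureTheory Measure Set NumberField IsDedekindDomain Matrix MulAction
open scoped ENNReal NNReal ValuativeRel Matrix MatrixGroups WithZero

namespace Summit.HodgeConjecture.HodgeConjecture.Cruxes.H413.F0P3cDyRamHProfilesTypeOneUnfolding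

open Literature.NumberTheory.Rogawski1990 Literature.NumberTheory.Automorphic Literature.NumberTheory.Automorphic.UnitaryGroup Literature.NumberTheory.Automorphic.IntegralReduction
open Literature.NumberTheory.GaloisRepresentations Literature.GroupTheory

section TypeOne

variable (L : Type) [Field L] [NumberField L] [IsCMField L] (v : HeightOneSpectrum (𝓞 ↥(maximalRealSubfield L)))
  (w : PlacesOver L v) (hw : IsCMField.complexConj L • w.1 = w.1)

/-! ## §1  Compact centralisers on the type-(1) elliptic population -/

set_option maxHeartbeats 400000 in
include hw in
/-- **`Z_{H_v}(γ_H)` IS COMPACT for a `G`-regular type-(1) ELLIPTIC `γ_H`** (split at `w`, not `H_v`-conjugate to a diagonal): the `G`-side centraliser of `x = ι_v(γ_H)` is compact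
(★ `compactSpace_centralizer_of_isLocalNormPair_of_isRoot` at the norm pair `γ_H ↔ ι_v(γ_H)`, `H′ = Φ₃`), and `Z_{H_v}(γ_H) ≃ₜ* Z_G(x)` (★ (Θ)).  The same for every `G`-regular
`γ_H′` stably conjugate to `γ_H` (it matches the same `x`). [cite: Rogawski1990, §12.5 p. 184; §4.9 Prop. 4.9.1 p. 55] -/
theorem isCompact_centralizer_of_typeOne
    {γH γH' : ((cmDatum L 2 (Matrix.of fun i j : Fin 2 => if i.val + j.val + 1 = 2 then (1 : L) else 0)).Local v × (cmDatum L 1 (Matrix.of fun i j : Fin 1 => if i.val + j.val + 1 = 1 then (1 : L) else 0)).Local v)} (hreg : IsLocalGRegular L v γH)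
    (hsplit : ∃ x : (w.1.adicCompletion L), ((((γH.1.val : GL (Fin 2) (UnitaryGroup.LocalRing L v)).val.map (Pi.evalRingHom (fun w' : PlacesOver L v => w'.1.adicCompletion L) w))).charpoly).IsRoot x)
    (hell : ¬ ∃ (y : ((cmDatum L 2 (Matrix.of fun i j : Fin 2 => if i.val + j.val + 1 = 2 then (1 : L) else 0)).Local v × (cmDatum L 1 (Matrix.of fun i j : Fin 1 => if i.val + j.val + 1 = 1 then (1 : L) else 0)).Local v)) (d' : Fin 2 → (UnitaryGroup.LocalRing L v)ˣ),
        glDiagonal 2 (UnitaryGroup.LocalRing L v) d' = ((y * γH * y⁻¹).1.val : GL (Fin 2) (UnitaryGroup.LocalRing L v)))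
    (hst : IsLocalStablyConjH L v γH γH') :
    IsCompact ((Subgroup.centralizer ({γH'} : Set ((cmDatum L 2 (Matrix.of fun i j : Fin 2 => if i.val + j.val + 1 = 2 then (1 : L) else 0)).Local v × (cmDatum L 1 (Matrix.of fun i j : Fin 1 => if i.val + j.val + 1 = 1 then (1 : L) else 0)).Local v)) : Subgroup ((cmDatum L 2 (Matrix.of fun i j : Fin 2 => if i.val + j.val + 1 = 2 then (1 : L) else 0)).Local v × (cmDatum L 1 (Matrix.of fun i j : Fin 1 => if i.val + j.val + 1 = 1 then (1 : L) else 0)).Local v)) : Set ((cmDatum L 2 (Matrix.of fun i j : Fin 2 => if i.val + j.val + 1 = 2 then (1 : L) else 0)).Local v × (cmDatum L 1 (Matrix.of fun i j : Fin 1 => if i.val + j.val + 1 = 1 then (1 : L) else 0)).Local v)) := by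
  -- the `G`-side centraliser of `x = ι_v(γ_H)` is compact
  have hxx : IsLocalNormPair L (Matrix.of fun i j : Fin 3 => if i.val + j.val + 1 = 3 then (1 : L) else 0) v γH (endoEmbLocal L v γH) := IsConj.refl _
  haveI hZG : CompactSpace (Subgroup.centralizer ({endoEmbLocal L v γH} : Set ((cmDatum L 3 (Matrix.of fun i j : Fin 3 => if i.val + j.val + 1 = 3 then (1 : L) else 0)).Local v))) :=
    compactSpace_centralizer_of_isLocalNormPair_of_isRoot L v (Matrix.of fun i j : Fin 3 => if i.val + j.val + 1 = 3 then (1 : L) else 0) w hw (antidiagOne_isHermitian L 3) (isUnit_antidiagOne_det L 3).ne_zero hreg hsplit hell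
      (endoEmbLocal L v γH) hxx
  -- `γ_H′` matches the same `x`; transport along (Θ)
  have hreg' : IsLocalGRegular L v γH' := isLocalGRegular_of_isLocalStablyConjH L v hst hreg
  have hx' : IsLocalNormPair L (Matrix.of fun i j : Fin 3 => if i.val + j.val + 1 = 3 then (1 : L) else 0) v γH' (endoEmbLocal L v γH) := (isLocalNormPair_iff_of_isLocalStablyConjH L v (Matrix.of fun i j : Fin 3 => if i.val + j.val + 1 = 3 then (1 : L) else 0) hst _).2 hxx
  obtain ⟨e, -, -, -⟩ := exists_localEndoCentralizerEquiv_normPair L v (isUnit_antidiagOne_det L 3).ne_zero hreg' hx'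
  haveI : CompactSpace (Subgroup.centralizer ({γH'} : Set ((cmDatum L 2 (Matrix.of fun i j : Fin 2 => if i.val + j.val + 1 = 2 then (1 : L) else 0)).Local v × (cmDatum L 1 (Matrix.of fun i j : Fin 1 => if i.val + j.val + 1 = 1 then (1 : L) else 0)).Local v))) := e.symm.toHomeomorph.compactSpace
  exact isCompact_iff_compactSpace.2 inferInstance

variable
  [MeasurableSpace ((cmDatum L 2 (Matrix.of fun i j : Fin 2 => if i.val + j.val + 1 = 2 then (1 : L) else 0)).Local v × (cmDatum L 1 (Matrix.of fun i j : Fin 1 => if i.val + j.val + 1 = 1 then (1 : L) else 0)).Local v)] [BorelSpace ((cmDatum L 2 (Matrix.of fun i j : Fin 2 => if i.val + j.val + 1 = 2 then (1 : L) else 0)).Local v × (cmDatum L 1 (Matrix.of fun i j : Fin 1 => if i.val + j.val + 1 = 1 then (1 : L) else 0)).Local v)]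
  [∀ a : ((cmDatum L 2 (Matrix.of fun i j : Fin 2 => if i.val + j.val + 1 = 2 then (1 : L) else 0)).Local v × (cmDatum L 1 (Matrix.of fun i j : Fin 1 => if i.val + j.val + 1 = 1 then (1 : L) else 0)).Local v), MeasurableSpace (((cmDatum L 2 (Matrix.of fun i j : Fin 2 => if i.val + j.val + 1 = 2 then (1 : L) else 0)).Local v × (cmDatum L 1 (Matrix.of fun i j : Fin 1 => if i.val + j.val + 1 = 1 then (1 : L) else 0)).Local v) ⧸ Subgroup.centralizer ({a} : Set ((cmDatum L 2 (Matrix.of fun i j : Fin 2 => if i.val + j.val + 1 = 2 then (1 : L) else 0)).Local v × (cmDatum L 1 (Matrix.of fun i j : Fin 1 => if i.val + j.val + 1 = 1 then (1 : L) else 0)).Local v)))]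
  [∀ a : ((cmDatum L 2 (Matrix.of fun i j : Fin 2 => if i.val + j.val + 1 = 2 then (1 : L) else 0)).Local v × (cmDatum L 1 (Matrix.of fun i j : Fin 1 => if i.val + j.val + 1 = 1 then (1 : L) else 0)).Local v), BorelSpace (((cmDatum L 2 (Matrix.of fun i j : Fin 2 => if i.val + j.val + 1 = 2 then (1 : L) else 0)).Local v × (cmDatum L 1 (Matrix.of fun i j : Fin 1 => if i.val + j.val + 1 = 1 then (1 : L) else 0)).Local v) ⧸ Subgroup.centralizer ({a} : Set ((cmDatum L 2 (Matrix.of fun i j : Fin 2 => if i.val + j.val + 1 = 2 then (1 : L) else 0)).Local v × (cmDatum L 1 (Matrix.of fun i j : Fin 1 => if i.val + j.val + 1 = 1 then (1 : L) else 0)).Local v)))]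
  (νH : Measure ((cmDatum L 2 (Matrix.of fun i j : Fin 2 => if i.val + j.val + 1 = 2 then (1 : L) else 0)).Local v × (cmDatum L 1 (Matrix.of fun i j : Fin 1 => if i.val + j.val + 1 = 1 then (1 : L) else 0)).Local v)) [νH.IsHaarMeasure] [νH.IsMulRightInvariant]

/-! ## §2  The two-class unfolding -/

set_option maxHeartbeats 400000 in
include hw in
/-- **BRICK (b′-1) · TYPE-(1) UNFOLDING, wild-safe: `Φ^st(γ_H, 1_{C × U₁}) = ν_H(C × U₁) · (#Fix_{γ₂}(U₂ ⧸ C) + #Fix_{γ₂′}(U₂ ⧸ C))`** for a `G`-regular type-(1) elliptic `γ_H`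
and a two-class datum `γ_H′` of its stable class, any compact open `C ≤ U(Φ₂)(L⁺_v)`, canonical `mH`, at ANY non-split place.
[cite: Rogawski1990, §4.3 (4.3.1) p. 43; §4.9 Lemma 4.9.3 p. 56; §3.6 p. 31] [cite: LabesseLanglands1979, §2] [cite: Kottwitz1988, §2] -/
theorem stableOrbitalIntegralRel_indicator_prod_top_eq_mul_add_of_typeOne
    {mH : OrbitalMeasureFamily ((cmDatum L 2 (Matrix.of fun i j : Fin 2 => if i.val + j.val + 1 = 2 then (1 : L) else 0)).Local v × (cmDatum L 1 (Matrix.of fun i j : Fin 1 => if i.val + j.val + 1 = 1 then (1 : L) else 0)).Local v)} (hmH : mH.IsCanonical (IsLocalGRegular L v) νH)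
    (C : Subgroup ((cmDatum L 2 (Matrix.of fun i j : Fin 2 => if i.val + j.val + 1 = 2 then (1 : L) else 0)).Local v)) (hCo : IsOpen (C : Set ((cmDatum L 2 (Matrix.of fun i j : Fin 2 => if i.val + j.val + 1 = 2 then (1 : L) else 0)).Local v))) (hCc : IsCompact (C : Set ((cmDatum L 2 (Matrix.of fun i j : Fin 2 => if i.val + j.val + 1 = 2 then (1 : L) else 0)).Local v)))
    {γH γH' : ((cmDatum L 2 (Matrix.of fun i j : Fin 2 => if i.val + j.val + 1 = 2 then (1 : L) else 0)).Local v × (cmDatum L 1 (Matrix.of fun i j : Fin 1 => if i.val + j.val + 1 = 1 then (1 : L) else 0)).Local v)} (hreg : IsLocalGRegular L v γH)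
    (hsplit : ∃ x : (w.1.adicCompletion L), ((((γH.1.val : GL (Fin 2) (UnitaryGroup.LocalRing L v)).val.map (Pi.evalRingHom (fun w' : PlacesOver L v => w'.1.adicCompletion L) w))).charpoly).IsRoot x)
    (hell : ¬ ∃ (y : ((cmDatum L 2 (Matrix.of fun i j : Fin 2 => if i.val + j.val + 1 = 2 then (1 : L) else 0)).Local v × (cmDatum L 1 (Matrix.of fun i j : Fin 1 => if i.val + j.val + 1 = 1 then (1 : L) else 0)).Local v)) (d' : Fin 2 → (UnitaryGroup.LocalRing L v)ˣ),
        glDiagonal 2 (UnitaryGroup.LocalRing L v) d' = ((y * γH * y⁻¹).1.val : GL (Fin 2) (UnitaryGroup.LocalRing L v)))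
    (hst : IsLocalStablyConjH L v γH γH') (hnc : ¬ IsConj γH γH') (hall : ∀ k, IsLocalStablyConjH L v γH k → IsConj γH k ∨ IsConj γH' k) :
    stableOrbitalIntegralRel (IsLocalStablyConjH L v) mH ((((C.prod (⊤ : Subgroup ((cmDatum L 1 (Matrix.of fun i j : Fin 1 => if i.val + j.val + 1 = 1 then (1 : L) else 0)).Local v))) : Subgroup (((cmDatum L 2 (Matrix.of fun i j : Fin 2 => if i.val + j.val + 1 = 2 then (1 : L) else 0)).Local v) × ((cmDatum L 1 (Matrix.of fun i j : Fin 1 => if i.val + j.val + 1 = 1 then (1 : L) else 0)).Local v))) : Set (((cmDatum L 2 (Matrix.of fun i j : Fin 2 => if i.val + j.val + 1 = 2 then (1 : L) else 0)).Local v) × ((cmDatum L 1 (Matrix.of fun i j : Fin 1 => if i.val + j.val + 1 = 1 then (1 : L) else 0)).Local v))).indicator (fun _ => (1 : ℂ))) γH =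
      (νH.real (((C.prod (⊤ : Subgroup ((cmDatum L 1 (Matrix.of fun i j : Fin 1 => if i.val + j.val + 1 = 1 then (1 : L) else 0)).Local v))) : Subgroup (((cmDatum L 2 (Matrix.of fun i j : Fin 2 => if i.val + j.val + 1 = 2 then (1 : L) else 0)).Local v) × ((cmDatum L 1 (Matrix.of fun i j : Fin 1 => if i.val + j.val + 1 = 1 then (1 : L) else 0)).Local v))) : Set (((cmDatum L 2 (Matrix.of fun i j : Fin 2 => if i.val + j.val + 1 = 2 then (1 : L) else 0)).Local v) × ((cmDatum L 1 (Matrix.of fun i j : Fin 1 => if i.val + j.val + 1 = 1 then (1 : L) else 0)).Local v))) : ℂ) *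
        ((Nat.card (fixedBy (((cmDatum L 2 (Matrix.of fun i j : Fin 2 => if i.val + j.val + 1 = 2 then (1 : L) else 0)).Local v) ⧸ C) γH.1) : ℂ) + (Nat.card (fixedBy (((cmDatum L 2 (Matrix.of fun i j : Fin 2 => if i.val + j.val + 1 = 2 then (1 : L) else 0)).Local v) ⧸ C) γH'.1) : ℂ)) := by
  -- compact centralisers of both representatives
  haveI : CompactSpace (Subgroup.centralizer ({γH} : Set ((cmDatum L 2 (Matrix.of fun i j : Fin 2 => if i.val + j.val + 1 = 2 then (1 : L) else 0)).Local v × (cmDatum L 1 (Matrix.of fun i j : Fin 1 => if i.val + j.val + 1 = 1 then (1 : L) else 0)).Local v))) :=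
    isCompact_iff_compactSpace.1 (isCompact_centralizer_of_typeOne L v w hw hreg hsplit hell (IsStablyConjH.refl _ _ _ γH))
  haveI : CompactSpace (Subgroup.centralizer ({γH'} : Set ((cmDatum L 2 (Matrix.of fun i j : Fin 2 => if i.val + j.val + 1 = 2 then (1 : L) else 0)).Local v × (cmDatum L 1 (Matrix.of fun i j : Fin 1 => if i.val + j.val + 1 = 1 then (1 : L) else 0)).Local v))) :=
    isCompact_iff_compactSpace.1 (isCompact_centralizer_of_typeOne L v w hw hreg hsplit hell hst)
  have hreg' : IsLocalGRegular L v γH' := isLocalGRegular_of_isLocalStablyConjH L v hst hreg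
  -- `C × U₁` is compact open (`U₁` is compact at a non-split place)
  haveI : CompactSpace ((cmDatum L 1 (Matrix.of fun i j : Fin 1 => if i.val + j.val + 1 = 1 then (1 : L) else 0)).Local v) :=
    compactSpace_cmDatum_local_one_of_smul_eq L (Matrix.of fun i j : Fin 1 => if i.val + j.val + 1 = 1 then (1 : L) else 0) w hw (isUnit_placeForm_antidiagOne (E := L) 1 w.1)
  have hopen : IsOpen (((C.prod (⊤ : Subgroup ((cmDatum L 1 (Matrix.of fun i j : Fin 1 => if i.val + j.val + 1 = 1 then (1 : L) else 0)).Local v))) : Subgroup (((cmDatum L 2 (Matrix.of fun i j : Fin 2 => if i.val + j.val + 1 = 2 then (1 : L) else 0)).Local v) × ((cmDatum L 1 (Matrix.of fun i j : Fin 1 => if i.val + j.val + 1 = 1 then (1 : L) else 0)).Local v))) : Set (((cmDatum L 2 (Matrix.of fun i j : Fin 2 => if i.val + j.val + 1 = 2 then (1 : L) else 0)).Local v) × ((cmDatum L 1 (Matrix.of fun i j : Fin 1 => if i.val + j.val + 1 = 1 then (1 : L) else 0)).Local v))) := by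
    rw [Subgroup.coe_prod, Subgroup.coe_top]; exact hCo.prod isOpen_univ
  have hcpt : IsCompact (((C.prod (⊤ : Subgroup ((cmDatum L 1 (Matrix.of fun i j : Fin 1 => if i.val + j.val + 1 = 1 then (1 : L) else 0)).Local v))) : Subgroup (((cmDatum L 2 (Matrix.of fun i j : Fin 2 => if i.val + j.val + 1 = 2 then (1 : L) else 0)).Local v) × ((cmDatum L 1 (Matrix.of fun i j : Fin 1 => if i.val + j.val + 1 = 1 then (1 : L) else 0)).Local v))) : Set (((cmDatum L 2 (Matrix.of fun i j : Fin 2 => if i.val + j.val + 1 = 2 then (1 : L) else 0)).Local v) × ((cmDatum L 1 (Matrix.of fun i j : Fin 1 => if i.val + j.val + 1 = 1 then (1 : L) else 0)).Local v))) := by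
    rw [Subgroup.coe_prod, Subgroup.coe_top]; exact hCc.prod isCompact_univ
  -- two classes
  rw [stableOrbitalIntegralRel_eq_add_of_two_classes (IsLocalStablyConjH L v) mH _ γH γH' (isLocalStablyConjH_of_isConj_and_conj L γH).1
    (isLocalStablyConjH_of_isConj_and_conj L γH).2 hst hnc hall]
  -- per class: the mass-carrying unfolding, then the compact factor `U₁`
  have h1 := classOrbitalIntegral_indicator_complex_eq_natCard_fixedBy_mul (P := IsLocalGRegular L v) (fun g x hg => (isLocalGRegular_conj_iff L x g).2 hg) hmH hreg
    (C.prod (⊤ : Subgroup ((cmDatum L 1 (Matrix.of fun i j : Fin 1 => if i.val + j.val + 1 = 1 then (1 : L) else 0)).Local v))) hopen hcpt (isClosed_conjClass_localH_of_isLocalGRegular L v γH hreg)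
  have h2 := classOrbitalIntegral_indicator_complex_eq_natCard_fixedBy_mul (P := IsLocalGRegular L v) (fun g x hg => (isLocalGRegular_conj_iff L x g).2 hg) hmH hreg'
    (C.prod (⊤ : Subgroup ((cmDatum L 1 (Matrix.of fun i j : Fin 1 => if i.val + j.val + 1 = 1 then (1 : L) else 0)).Local v))) hopen hcpt (isClosed_conjClass_localH_of_isLocalGRegular L v γH' hreg')
  have hp1 := natCard_fixedBy_quotient_prod_top_eq (A := ((cmDatum L 1 (Matrix.of fun i j : Fin 1 => if i.val + j.val + 1 = 1 then (1 : L) else 0)).Local v)) C γH.1 γH.2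
  have hp2 := natCard_fixedBy_quotient_prod_top_eq (A := ((cmDatum L 1 (Matrix.of fun i j : Fin 1 => if i.val + j.val + 1 = 1 then (1 : L) else 0)).Local v)) C γH'.1 γH'.2
  rw [Prod.mk.eta] at hp1 hp2
  rw [h1, h2, hp1, hp2, measureReal_def]
  ring

end TypeOne

end Summit.HodgeConjecture.HodgeConjecture.Cruxes.H413.F0P3cDyRamHProfilesTypeOneUnfolding

end
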